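import Mathlib
import Literature.Barriers.CriticalPhenomena.LaceExpansionGaussianLargeT
import HarnessLib

/-!
# Fibred Born–Oppenheimer blocks — part 9: `L²`-Lipschitz bound for Gaussian-type fibre profiles (the input of the transport budget)
# (route `FlatTubeReduction`, crux K1 `NearFlatRatioLaw` stmt-QuantumFields-24720, registered stub `stub_boRate` = FCL 23943's `BORateAll`;
# rung R2b1 = RECORD-label femto gap; no summit statement is proved here)

Seat `ym-line-ftr-p1` g6 (prover).  Part 6 (`…FibredBOTransport.transportSq_le_of_mul`) reduces the CROSS/FLOOR/linear-DIAG budgets of the fibred model to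
`‖m_cΩ_c − m_{c'}Ω_{c'}‖²_{L²}`.  For Gaussian-type weighted profiles `e^{−A_c(w)}` (the c-frozen stiff model: `A_c(w) = ⟪w,(A_c + Γ_c)w⟫`, uniformly coercive
along the slow manifold and Lipschitz in `c` as quadratic forms) this is an explicit Gaussian estimate on a finite-dimensional real inner-product space `V`
(`n = dim V`, Lebesgue measure):
* (reused from the tree: `Literature.Barriers.CriticalPhenomena.abs_exp_neg_sub_exp_neg_le` — `|e^{−a} − e^{−b}| ≤ |a − b|·e^{−p}` for `p ≤ a, b`);
* `sq_mul_exp_neg_mul_le` — `t²e^{−pt} ≤ 4e^{−2}/p²` (`p > 0`, `t ≥ 0`);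
* ★★ `integral_sq_exp_sub_exp_le` — if `A, A' ≥ p‖w‖²` pointwise (`p > 0`) and `|A(w) − A'(w)| ≤ δ‖w‖²`, then
  `∫ (e^{−A(w)} − e^{−A'(w)})² dw ≤ δ²·(4e^{−2}/p²)·(π/p)^{n/2}` — quadratic in the form-distance `δ` (= `‖P_c − P_{c'}‖ ≲ |c − c'|`), as the second-order budget wants.
HONEST FRAMING: a Gaussian integral estimate for the registered stub of a crux of the CONDITIONAL reduction route to the femto rung R2b1 (RECORD label); the chart
and the stiffness family are OPEN (route RED lane A C4-CORE + the rate twin); nothing here is infinite volume, a continuum limit or the Clay mass gap.  No definitions,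
no named facts, no `sorry`.

## References
* A. Wipf, *Statistical Approach to Quantum Field Theory*, LNP 992, Springer 2021, §8.5.1 (Gaussian transfer kernels and their ground states) — [cite: Wipf2021, §8.5.1].
-/

set_option autoImplicit false

noncomputable section

open MeasureTheory Real

namespace Summit.QuantumFields.YangMills.Theorems.FemtoTransferGap.FibredBO

/-- `t²·e^{−pt} ≤ 4e^{−2}/p²` for `p > 0`, `t ≥ 0` (from `x ≤ e^{x−1}` at `x = pt/2`). [folklore] -/
theorem sq_mul_exp_neg_mul_le {p t : ℝ} (hp : 0 < p) (ht : 0 ≤ t) : t ^ 2 * Real.exp (-(p * t)) ≤ 4 * Real.exp (-2) / p ^ 2 := by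
  have hx : p * t / 2 ≤ Real.exp (p * t / 2 - 1) := by linarith [Real.add_one_le_exp (p * t / 2 - 1)]
  have hx0 : 0 ≤ p * t / 2 := by positivity
  have hsq : (p * t / 2) ^ 2 ≤ Real.exp (p * t / 2 - 1) ^ 2 := pow_le_pow_left₀ hx0 hx 2
  have he : Real.exp (p * t / 2 - 1) ^ 2 = Real.exp (p * t) * Real.exp (-2) := by
    rw [← Real.exp_nat_mul, ← Real.exp_add]; ring_nf
  rw [he] at hsq
  have hE : 0 < Real.exp (-(p * t)) := Real.exp_pos _
  have hprod : Real.exp (p * t) * Real.exp (-(p * t)) = 1 := by rw [← Real.exp_add]; simp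
  rw [le_div_iff₀ (by positivity)]
  have h := mul_le_mul_of_nonneg_right hsq hE.le
  calc t ^ 2 * Real.exp (-(p * t)) * p ^ 2 = 4 * ((p * t / 2) ^ 2 * Real.exp (-(p * t))) := by ring
    _ ≤ 4 * (Real.exp (p * t) * Real.exp (-2) * Real.exp (-(p * t))) := mul_le_mul_of_nonneg_left h (by norm_num)
    _ = 4 * Real.exp (-2) := by
        rw [show Real.exp (p * t) * Real.exp (-2) * Real.exp (-(p * t)) = Real.exp (-2) * (Real.exp (p * t) * Real.exp (-(p * t))) by ring,
          hprod, mul_one]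

variable {V : Type*} [NormedAddCommGroup V] [InnerProductSpace ℝ V] [FiniteDimensional ℝ V] [MeasurableSpace V] [BorelSpace V]

/-- ★★ **`L²`-Lipschitz bound for Gaussian-type profiles**: if `A(w) ≥ p‖w‖²`, `A'(w) ≥ p‖w‖²` (`p > 0`) and `|A(w) − A'(w)| ≤ δ‖w‖²` for all `w`, then
`∫ (e^{−A(w)} − e^{−A'(w)})² dw ≤ δ²·(4e^{−2}/p²)·(π/p)^{n/2}`, `n = dim V`.  (No integrability hypothesis: the left side is `0` by convention if not integrable.)
[cite: Wipf2021, §8.5.1] -/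
theorem integral_sq_exp_sub_exp_le {A A' : V → ℝ} {p δ : ℝ} (hp : 0 < p)
    (hA : ∀ w, p * ‖w‖ ^ 2 ≤ A w) (hA' : ∀ w, p * ‖w‖ ^ 2 ≤ A' w) (hd : ∀ w, |A w - A' w| ≤ δ * ‖w‖ ^ 2) :
    ∫ w, (Real.exp (-(A w)) - Real.exp (-(A' w))) ^ 2 ≤
      δ ^ 2 * (4 * Real.exp (-2) / p ^ 2) * (π / p) ^ ((Module.finrank ℝ V : ℝ) / 2) := by
  -- the Gaussian majorant and its integral
  have hg := GaussianFourier.integral_rexp_neg_mul_sq_norm (V := V) hp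
  simp only [neg_mul] at hg
  have hG : Integrable (fun w : V => Real.exp (-(p * ‖w‖ ^ 2))) := by
    refine Integrable.of_integral_ne_zero ?_
    rw [hg]
    positivity
  -- pointwise bound
  have hpt : ∀ w : V, (Real.exp (-(A w)) - Real.exp (-(A' w))) ^ 2 ≤ δ ^ 2 * (4 * Real.exp (-2) / p ^ 2) * Real.exp (-(p * ‖w‖ ^ 2)) := by
    intro w
    have h1 := Literature.Barriers.CriticalPhenomena.abs_exp_neg_sub_exp_neg_le (hA w) (hA' w)
    have h2 : |Real.exp (-(A w)) - Real.exp (-(A' w))| ≤ δ * ‖w‖ ^ 2 * Real.exp (-(p * ‖w‖ ^ 2)) :=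
      h1.trans (mul_le_mul_of_nonneg_right (hd w) (Real.exp_pos _).le)
    have h3 : (Real.exp (-(A w)) - Real.exp (-(A' w))) ^ 2 ≤ (δ * ‖w‖ ^ 2 * Real.exp (-(p * ‖w‖ ^ 2))) ^ 2 := by
      rw [← sq_abs]
      exact pow_le_pow_left₀ (abs_nonneg _) h2 2
    have h4 := sq_mul_exp_neg_mul_le hp (sq_nonneg ‖w‖)
    have h5 : (δ * ‖w‖ ^ 2 * Real.exp (-(p * ‖w‖ ^ 2))) ^ 2 =
        δ ^ 2 * ((‖w‖ ^ 2) ^ 2 * Real.exp (-(p * ‖w‖ ^ 2))) * Real.exp (-(p * ‖w‖ ^ 2)) := by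
      rw [mul_pow, mul_pow, sq (Real.exp _)]
      ring
    rw [h5] at h3
    refine h3.trans ?_
    have h6 : δ ^ 2 * ((‖w‖ ^ 2) ^ 2 * Real.exp (-(p * ‖w‖ ^ 2))) ≤ δ ^ 2 * (4 * Real.exp (-2) / p ^ 2) :=
      mul_le_mul_of_nonneg_left h4 (sq_nonneg _)
    exact mul_le_mul_of_nonneg_right h6 (Real.exp_pos _).le
  calc ∫ w, (Real.exp (-(A w)) - Real.exp (-(A' w))) ^ 2
      ≤ ∫ w, δ ^ 2 * (4 * Real.exp (-2) / p ^ 2) * Real.exp (-(p * ‖w‖ ^ 2)) :=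
        integral_mono_of_nonneg (ae_of_all _ fun w => sq_nonneg _) (hG.const_mul _) (ae_of_all _ hpt)
    _ = δ ^ 2 * (4 * Real.exp (-2) / p ^ 2) * (π / p) ^ ((Module.finrank ℝ V : ℝ) / 2) := by
        rw [integral_const_mul, hg]

end Summit.QuantumFields.YangMills.Theorems.FemtoTransferGap.FibredBO

end
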